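import Summits.HodgeConjecture.HodgeConjecture.Theses.EightfoldBlochSeeds
import Literature.AlgebraicGeometry.HodgeTheory.WeilClassesFourfoldsProofs
import Literature.AlgebraicGeometry.Motives.AbelianVarietyProductDimProofs
import Literature.AlgebraicGeometry.Motives.AimedSplitProductDischarge
import Literature.NumberTheory.EllipticCurves.CMEndomorphismOfMulMemLattice
import HarnessLib

/-!
# `Cruxes/BlochSeedDiscOne/Anchor.lean` — the SORRY-FREE pad-4 anchor vocabulary (crux `EightfoldBlochSeeds.BlochSeedDiscOne`,
# item stmt-HodgeConjecture-18881)

A verbatim, sorry-free copy of §0 «Anchor» of the registered skeleton `Lines/birth.lean` (sha16 814a6a70c14e831a, bc5-witness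
planner `hodge-bloch-bc5-plan`), extracted at the request of the critic of record (idea-crit-6 g3, LENS RULING L2 price T4
«SKELETON-IMPORT HYGIENE», ladder-directors/REQUESTS.md 2026-08-28): Sketches of lens / ideator seats that need the named anchor
`S⁴ = ((S × S) × S) × S`, `S = E₀ × E₀`, `φ_S = ψ₀ × (-ψ₀)` must NOT import `Lines/birth.lean`, because its composition
`Birth.BlochSeedDiscOne_of_pad4 : BlochSeedDiscOne` rests on the sorried STUB R and makes every `C → BlochSeedDiscOne` probe
(`#h21_crux_probe`, BC2/BC7 P5) close by `exact?` — a sorry-tainted false positive.  Import THIS file instead.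

Contents (namespace `…Cruxes.BlochSeedDiscOne.Anchor`; the decl names are those of `Lines/birth.lean` §0, the bodies are
byte-identical `abbrev`s, so `Anchor.pad4Anchor E₀` and `Birth.pad4Anchor E₀` are definitionally equal — reducible — and a
stub proved over one vocabulary transports to the other by `rfl`/`Iff.rfl`):
* `weilSurf`, `weilSurfAct`, `pad2Anchor`, `pad3Anchor`, `pad4Anchor`, `pad2Action`, `pad3Action`, `pad4Action`, `symH`;
* PROVED: `weilSurf_dim`, `pad4Anchor_dim` (`dim S⁴ = 2·4`), `neg_comp_neg_eq`, `weilSurfAct_comp_self`,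
  `pad4Action_comp_self` (`ψ ≫ ψ = -1` on `S⁴`);
* PROVED (new, hypothesis-carrying, hence not `exact?`-abusable): `blochSeedDiscOne_of_forall_pad4_seedAt` — ANY proof of
  the STUB-R-shaped statement «on every CM anchor `(E₀, ψ₀)`, `ψ₀² = -1`, there is hyperbolic Bloch-seed data on
  `pad4Anchor E₀`» gives the crux `BlochSeedDiscOne` BY NAME (the composition of `Lines/birth.lean`, with the stub as an
  explicit hypothesis instead of a sorried theorem).

No stub, no `sorry`, no new mathematics.  HC / HC_AV / `BlochSeedDiscOne` are NOT proved here.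
-/

noncomputable section

set_option linter.dupNamespace false

open CategoryTheory AlgebraicGeometry
open Literature.AlgebraicGeometry Literature.AlgebraicGeometry.Motives Literature.AlgebraicGeometry.HodgeTheory
open Literature.AlgebraicTopology.SingularHomology


namespace Summit.HodgeConjecture.HodgeConjecture.Cruxes.BlochSeedDiscOne.Anchor

universe u

/-! ## §0 The named anchor `S⁴`, `S = E₀ × E₀`, `φ_S = ψ₀ × (-ψ₀)` -/

section Anchor

variable (E₀ : AbelianVariety ℂ) (ψ₀ : E₀ ⟶ E₀)

/-- The Weil surface `S = E₀ × E₀`. -/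
abbrev weilSurf : AbelianVariety ℂ := E₀.prod E₀

/-- Its Weil action `φ_S = ψ₀ × (-ψ₀)` (the tree's `exists_weilType_cmSquare`). -/
abbrev weilSurfAct : weilSurf E₀ ⟶ weilSurf E₀ :=
  AbelianVariety.prodLift (AbelianVariety.fst E₀ E₀ ≫ ψ₀) (AbelianVariety.snd E₀ E₀ ≫ (-ψ₀))

/-- `S²  = S × S`. -/
abbrev pad2Anchor : AbelianVariety ℂ := (weilSurf E₀).prod (weilSurf E₀)
/-- `S³ = S² × S`. -/
abbrev pad3Anchor : AbelianVariety ℂ := (pad2Anchor E₀).prod (weilSurf E₀)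
/-- **The PAD-4 anchor** `S⁴ = S³ × S` (as a complex torus `≅ E₀⁸`; the Weil structure is `(i,-i)⁴`). -/
abbrev pad4Anchor : AbelianVariety ℂ := (pad3Anchor E₀).prod (weilSurf E₀)

/-- Product action on `S²`. -/
abbrev pad2Action : pad2Anchor E₀ ⟶ pad2Anchor E₀ :=
  AbelianVariety.prodLift (AbelianVariety.fst _ _ ≫ weilSurfAct E₀ ψ₀) (AbelianVariety.snd _ _ ≫ weilSurfAct E₀ ψ₀)
/-- Product action on `S³`. -/
abbrev pad3Action : pad3Anchor E₀ ⟶ pad3Anchor E₀ :=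
  AbelianVariety.prodLift (AbelianVariety.fst _ _ ≫ pad2Action E₀ ψ₀) (AbelianVariety.snd _ _ ≫ weilSurfAct E₀ ψ₀)
/-- **The PAD-4 action** `ψ = φ_S × φ_S × φ_S × φ_S` on `S⁴`, in the nested shape `prodLift (fst ≫ ·) (snd ≫ φ_S)` that
`aimedSplitProduct_cmSquare_of_pos` consumes. -/
abbrev pad4Action : pad4Anchor E₀ ⟶ pad4Anchor E₀ :=
  AbelianVariety.prodLift (AbelianVariety.fst _ _ ≫ pad3Action E₀ ψ₀) (AbelianVariety.snd _ _ ≫ weilSurfAct E₀ ψ₀)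

/-- The `K`-symmetrised hyperplane class `h_K(e, a) = 1·ι^*a + ψ^*ι^*a` at `d = 1` (the literal shape inside
`HasHyperbolicBlochSeed 4 1`). -/
abbrev symH {P : AbelianVariety ℂ} (ψ : P ⟶ P) (e : ProjectiveEmbedding P.X)
    (a : complexBetti (projectiveSpace e.n ℂ) 2) : complexBetti P.X 2 :=
  ((1 : ℕ) : ℂ) • complexBetti.map e.ι 2 a + complexBetti.map ψ.hom.hom.hom 2 (complexBetti.map e.ι 2 a)

variable {E₀ ψ₀}

/-- `dim S = 2·1`. -/
theorem weilSurf_dim (hE : E₀.dim = 1) : (weilSurf E₀).dim = 2 * 1 := by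
  show (E₀.prod E₀).dim = 2 * 1
  rw [AbelianVariety.dim_prod, hE]

/-- `dim S⁴ = 2·4`. -/
theorem pad4Anchor_dim (hE : E₀.dim = 1) : (pad4Anchor E₀).dim = 2 * 4 := by
  have h1 := weilSurf_dim hE
  have h2 : (pad2Anchor E₀).dim = 2 * (1 + 1) := dim_prod_eq_two_mul h1 h1
  have h3 : (pad3Anchor E₀).dim = 2 * ((1 + 1) + 1) := dim_prod_eq_two_mul h2 h1
  have h4 : (pad4Anchor E₀).dim = 2 * (((1 + 1) + 1) + 1) := dim_prod_eq_two_mul h3 h1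
  simpa using h4

/-- `(-ψ₀)² = ψ₀²`. -/
theorem neg_comp_neg_eq (hψ : ψ₀ ≫ ψ₀ = -(1 • 𝟙 E₀)) : (-ψ₀) ≫ (-ψ₀) = -(1 • 𝟙 E₀) := by
  rw [Preadditive.neg_comp_neg]; exact hψ

/-- `φ_S ≫ φ_S = -1`. -/
theorem weilSurfAct_comp_self (hψ : ψ₀ ≫ ψ₀ = -(1 • 𝟙 E₀)) :
    weilSurfAct E₀ ψ₀ ≫ weilSurfAct E₀ ψ₀ = -(1 • 𝟙 (weilSurf E₀)) :=
  prodLift_comp_self_eq_neg_nsmul hψ (neg_comp_neg_eq hψ)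

/-- **`ψ ≫ ψ = -1` on `S⁴`.** -/
theorem pad4Action_comp_self (hψ : ψ₀ ≫ ψ₀ = -(1 • 𝟙 E₀)) :
    pad4Action E₀ ψ₀ ≫ pad4Action E₀ ψ₀ = -(1 • 𝟙 (pad4Anchor E₀)) := by
  have hS := weilSurfAct_comp_self hψ
  have h2 : pad2Action E₀ ψ₀ ≫ pad2Action E₀ ψ₀ = -(1 • 𝟙 (pad2Anchor E₀)) :=
    prodLift_comp_self_eq_neg_nsmul hS hS
  have h3 : pad3Action E₀ ψ₀ ≫ pad3Action E₀ ψ₀ = -(1 • 𝟙 (pad3Anchor E₀)) :=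
    prodLift_comp_self_eq_neg_nsmul h2 hS
  exact prodLift_comp_self_eq_neg_nsmul h3 hS

end Anchor

/-! ## The composition with the rung as an explicit hypothesis -/

/-- **`BlochSeedDiscOne` from STUB-R-shaped data on the named anchors** (sorry-free; the hypothesis is exactly the statement
of `Lines/birth.lean`'s `stub_rung_pad4_seedAt`, universally quantified over the CM anchor). Uses the tree's
`exists_cmCurve_sqrt_neg 1` (a complex elliptic curve with `ψ₀ ≫ ψ₀ = -1` exists). -/
theorem blochSeedDiscOne_of_forall_pad4_seedAt
    (h : ∀ (E₀ : AbelianVariety ℂ) (ψ₀ : E₀ ⟶ E₀), E₀.dim = 1 → ψ₀ ≫ ψ₀ = -(1 • 𝟙 E₀) →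
      ∃ (e : ProjectiveEmbedding (pad4Anchor E₀).X) (a : complexBetti (projectiveSpace e.n ℂ) 2)
        (w : complexBetti (pad4Anchor E₀).X (2 * 4)),
        IsRationalClass a ∧ a ≠ 0 ∧
        IsHyperbolicWeilType (pad4Anchor E₀) (pad4Action E₀ ψ₀) 4 (symH (pad4Action E₀ ψ₀) e a) ∧
        w ∈ weilClassesOf (pad4Anchor E₀) (pad4Action E₀ ψ₀) 4 1 ∧ IsRationalClass w ∧ w ≠ 0 ∧
        HasBlochSeedAt 4 (pad4Anchor E₀) (symH (pad4Action E₀ ψ₀) e a) w) :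
    Summit.HodgeConjecture.HodgeConjecture.Theses.EightfoldBlochSeeds.BlochSeedDiscOne := by
  obtain ⟨E₀, ψ₀, hE, hψ⟩ :=
    Literature.NumberTheory.EllipticCurves.CMEndomorphism.exists_cmCurve_sqrt_neg 1 one_pos
  obtain ⟨e, a, w, ha, ha0, hhyp, hwW, hwr, hw0, hseed⟩ := h E₀ ψ₀ hE hψ
  exact ⟨pad4Anchor E₀, pad4Action E₀ ψ₀, e, a, w, pad4Anchor_dim hE, pad4Action_comp_self hψ, ha, ha0, hhyp,
    hwW, hwr, hw0, hseed⟩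

end Summit.HodgeConjecture.HodgeConjecture.Cruxes.BlochSeedDiscOne.Anchor

end
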